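import Summits.QuantumFields.BalabanUV.T4Continuum.Support.NE7K1LinWalkParametrix

/-!
# NE7K1LinWalkPad — row NE7 (node U5), candidate route HOM, path H1L, cell K1-lin(s): THE PADDED OPERATOR `P ⊕ 1` ON A LARGER INDEX SET —
# coercivity, (H-comm) and cut-off compatibility TRANSFER from `P`, and `(pad P)⁻¹ = pad P⁻¹`

Lineage `b2b-balaban-t4-ne7-p2` (CRUX PROVER NE7 #2), generation 71; series (RW) file 23 (pure finite linear algebra over file 1
`NE7K1LinWalkParametrix`; the device of file 24 `NE7K1LinWalkDeltaRegion`, B4's `δG` clause (1.11)–(1.12) at `A = 0`).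
[Balaban1983RegularityDecay] = T. Bałaban, Commun. Math. Phys. 89 (1983) 571–597, p. 579: *"we take the representations (2.13) for both
propagators"* — the two propagators `G_k(Ω,A)`, `G_k(Ω₀,A)` (`Ω ⊂ Ω₀`) act on functions on DIFFERENT site sets, while the cancellation argument
(tree: `B4RandomWalkDelta112`, file 22 `NE7K1LinWalkDelta`) compares two expansions in ONE operator algebra.  THE DEVICE ([folklore]): for finsets
`Ω ⊆ Ω₀` of any type and a matrix `P` on `↥Ω`, the PADDED OPERATOR `pad Ω Ω₀ P` on `↥Ω₀` is `P` on the `Ω × Ω` block and the IDENTITY on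
`Ω₀ ∖ Ω`, with no coupling between the two:

* `pad_apply_mem_mem ∕ _mem_not_mem ∕ _not_mem`, `pad_incl`; `sum_dite_mem` (sums of zero-extensions); `pad_mulVec` (`P(v|Ω)` inside, `v` outside);
* `pad_form`: `⟨v, pad P v⟩ = ⟨v|Ω, P v|Ω⟩ + Σ_{Ω₀∖Ω} v²` ⇒ **`pad_coercive`**: floor `min(σ,1)` when `P` is `σ`-coercive;
* `pad_mul`, `pad_one` ⇒ **`pad_inv`**: `(pad P)⁻¹ = pad P⁻¹` — the inverse of the padded operator restricted to `Ω × Ω` IS `P⁻¹`;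
* `comm_pad_mulVec ∕ comm_pad_sq`: the cut-off commutator `[diag l, pad P]v` is the zero-extension of `[diag(l|Ω), P](v|Ω)` ⇒ **`hcomm_pad`**:
  B4 Lemma 2.1's (H-comm) shape `‖[diag l, ·]v‖² ≤ α²⟨v,·v⟩ + β²‖v‖²` TRANSFERS from `P` to `pad P` with the SAME constants;
* **`cutoffOn_pad`**: `NE7K1LinWalkParametrix.CutoffOn` transfers from an operator on `Ω₀` with the same off-diagonal entries inside `Ω × Ω`.

So the abstract walk expansion of files 1–3 and the abstract `δG` clause of file 22 run for the pair (`pad Ω Ω₀ P_Ω`, `P_{Ω₀}`) on the common index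
set `↥Ω₀`, and the result is read off on `Ω × Ω`.

HONEST FRAMING: [folklore] finite linear algebra; no lattice, no operator of Bałaban's (file 24 instantiates at A = 0); no `sorry`.  Census only;
NO letter ∕ tag ∕ size of NE7 moves; NE7 NOT PRINTED ∕ NOT PROVED; spine 0∕9; FIXED FINITE T⁴, rung (B)+1; NOT infinite volume, NOT mass gap, NOT
Clay.  HONEST DEPENDENCY: continuum YM on T⁴ ⇐ BetaPertH ∧ nine spine estimates (0/9 proved); BetaPertH ⇐ (D1) ∧ (D4) ∧ CAP+tail; G-an2-4
gates asym, D1 and NE2/3/4.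
-/

noncomputable section

open Finset Matrix

namespace Summit.QuantumFields.BalabanUV.T4Continuum.NE7K1LinWalkPad

open NE7K1LinWalkParametrix

section Pad

variable {α : Type*} [DecidableEq α] {Ω Ω₀ : Finset α}

/-- the inclusion of index sets `↥Ω → ↥Ω₀` for `Ω ⊆ Ω₀`. [folklore] -/
def incl (hΩ : Ω ⊆ Ω₀) (x : ↥Ω) : ↥Ω₀ := ⟨x.1, hΩ x.2⟩

/-- **THE PADDED OPERATOR**: `P` (a matrix on `Ω`) on the `Ω × Ω` block of `Ω₀`, the IDENTITY on `Ω₀ ∖ Ω`, no coupling between them.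
Its inverse restricted to `Ω × Ω` is `P⁻¹` (`pad_inv`). [folklore] -/
def pad (Ω Ω₀ : Finset α) (P : Matrix ↥Ω ↥Ω ℝ) : Matrix ↥Ω₀ ↥Ω₀ ℝ :=
  Matrix.of fun x y => if hx : x.1 ∈ Ω then (if hy : y.1 ∈ Ω then P ⟨x.1, hx⟩ ⟨y.1, hy⟩ else 0) else (if y = x then 1 else 0)

/-- a sum over `↥Ω₀` of the extension by zero of a function on `↥Ω` is the sum over `↥Ω`. [folklore] -/
theorem sum_dite_mem (hΩ : Ω ⊆ Ω₀) (f : ↥Ω → ℝ) :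
    ∑ y : ↥Ω₀, (if hy : y.1 ∈ Ω then f ⟨y.1, hy⟩ else 0) = ∑ y' : ↥Ω, f y' := by
  set g : α → ℝ := fun z => if hz : z ∈ Ω then f ⟨z, hz⟩ else 0 with hg
  have h1 : ∑ y : ↥Ω₀, (if hy : y.1 ∈ Ω then f ⟨y.1, hy⟩ else 0) = ∑ z ∈ Ω₀, g z := Finset.sum_coe_sort Ω₀ g
  have h2 : ∑ y' : ↥Ω, f y' = ∑ z ∈ Ω, g z := by
    rw [← Finset.sum_coe_sort Ω g]
    exact Finset.sum_congr rfl fun y' _ => by simp only [hg, dif_pos y'.2, Subtype.coe_eta]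
  rw [h1, h2]
  exact (Finset.sum_subset hΩ fun z _ hz => by simp [hg, hz]).symm

/-- entries of the padded operator inside `Ω × Ω`. [folklore] -/
theorem pad_apply_mem_mem (P : Matrix ↥Ω ↥Ω ℝ) {x y : ↥Ω₀} (hx : x.1 ∈ Ω) (hy : y.1 ∈ Ω) :
    pad Ω Ω₀ P x y = P ⟨x.1, hx⟩ ⟨y.1, hy⟩ := by
  simp only [pad, Matrix.of_apply]
  rw [dif_pos hx, dif_pos hy]

/-- no coupling from `Ω` to `Ω₀ ∖ Ω`. [folklore] -/
theorem pad_apply_mem_not_mem (P : Matrix ↥Ω ↥Ω ℝ) {x y : ↥Ω₀} (hx : x.1 ∈ Ω) (hy : y.1 ∉ Ω) :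
    pad Ω Ω₀ P x y = 0 := by
  simp only [pad, Matrix.of_apply]
  rw [dif_pos hx, dif_neg hy]

/-- identity rows on `Ω₀ ∖ Ω`. [folklore] -/
theorem pad_apply_not_mem (P : Matrix ↥Ω ↥Ω ℝ) {x : ↥Ω₀} (hx : x.1 ∉ Ω) (y : ↥Ω₀) :
    pad Ω Ω₀ P x y = if y = x then 1 else 0 := by
  simp only [pad, Matrix.of_apply]
  rw [dif_neg hx]

/-- at the included points the padded operator acts as `P`. [folklore] -/
theorem pad_incl (hΩ : Ω ⊆ Ω₀) (P : Matrix ↥Ω ↥Ω ℝ) (x' y' : ↥Ω) : pad Ω Ω₀ P (incl hΩ x') (incl hΩ y') = P x' y' :=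
  pad_apply_mem_mem P (x := incl hΩ x') (y := incl hΩ y') x'.2 y'.2

/-- **THE PADDED OPERATOR APPLIED TO A VECTOR**: `P(v|Ω)` inside `Ω`, `v` outside. [folklore] -/
theorem pad_mulVec (hΩ : Ω ⊆ Ω₀) (P : Matrix ↥Ω ↥Ω ℝ) (v : ↥Ω₀ → ℝ) (x : ↥Ω₀) :
    (pad Ω Ω₀ P *ᵥ v) x = if hx : x.1 ∈ Ω then (P *ᵥ (v ∘ incl hΩ)) ⟨x.1, hx⟩ else v x := by
  simp only [mulVec, dotProduct]
  by_cases hx : x.1 ∈ Ω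
  · rw [dif_pos hx]
    have h : ∀ y : ↥Ω₀, pad Ω Ω₀ P x y * v y =
        if hy : y.1 ∈ Ω then (fun y' : ↥Ω => P ⟨x.1, hx⟩ y' * v (incl hΩ y')) ⟨y.1, hy⟩ else 0 := by
      intro y
      by_cases hy : y.1 ∈ Ω
      · rw [dif_pos hy, pad_apply_mem_mem P hx hy]
        rfl
      · rw [dif_neg hy, pad_apply_mem_not_mem P hx hy, zero_mul]
    exact (Finset.sum_congr rfl fun y _ => h y).trans
      (sum_dite_mem hΩ (fun y' : ↥Ω => P ⟨x.1, hx⟩ y' * v (incl hΩ y')))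
  · rw [dif_neg hx]
    simp_rw [pad_apply_not_mem P hx]
    simp

/-- the squared norm splits into the part on `Ω` and the part outside. [folklore] -/
theorem dot_split (hΩ : Ω ⊆ Ω₀) (v : ↥Ω₀ → ℝ) :
    v ⬝ᵥ v = (v ∘ incl hΩ) ⬝ᵥ (v ∘ incl hΩ) + ∑ x ∈ univ.filter (fun x : ↥Ω₀ => x.1 ∉ Ω), v x * v x := by
  simp only [dotProduct, Finset.sum_filter]
  have h : ∀ x : ↥Ω₀, v x * v x = (if hx : x.1 ∈ Ω then (fun x' : ↥Ω => (v ∘ incl hΩ) x' * (v ∘ incl hΩ) x') ⟨x.1, hx⟩ else 0) +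
      (if x.1 ∉ Ω then v x * v x else 0) := by
    intro x
    by_cases hx : x.1 ∈ Ω
    · rw [dif_pos hx, if_neg (not_not.mpr hx), add_zero]
      rfl
    · rw [dif_neg hx, if_pos hx, zero_add]
  rw [Finset.sum_congr rfl fun x _ => h x, Finset.sum_add_distrib,
    sum_dite_mem hΩ (fun x' : ↥Ω => (v ∘ incl hΩ) x' * (v ∘ incl hΩ) x')]

/-- **THE FORM OF THE PADDED OPERATOR**: `⟨v, pad P v⟩ = ⟨v|Ω, P v|Ω⟩ + Σ_{x ∉ Ω} v_x²`. [folklore] -/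
theorem pad_form (hΩ : Ω ⊆ Ω₀) (P : Matrix ↥Ω ↥Ω ℝ) (v : ↥Ω₀ → ℝ) :
    v ⬝ᵥ pad Ω Ω₀ P *ᵥ v = (v ∘ incl hΩ) ⬝ᵥ P *ᵥ (v ∘ incl hΩ) + ∑ x ∈ univ.filter (fun x : ↥Ω₀ => x.1 ∉ Ω), v x * v x := by
  simp only [dotProduct, Finset.sum_filter]
  have h : ∀ x : ↥Ω₀, v x * (pad Ω Ω₀ P *ᵥ v) x = (if hx : x.1 ∈ Ω then
      (fun x' : ↥Ω => (v ∘ incl hΩ) x' * (P *ᵥ (v ∘ incl hΩ)) x') ⟨x.1, hx⟩ else 0) + (if x.1 ∉ Ω then v x * v x else 0) := by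
    intro x
    rw [pad_mulVec hΩ]
    by_cases hx : x.1 ∈ Ω
    · rw [dif_pos hx, dif_pos hx, if_neg (not_not.mpr hx), add_zero]
      rfl
    · rw [dif_neg hx, dif_neg hx, if_pos hx, zero_add]
  rw [Finset.sum_congr rfl fun x _ => h x, Finset.sum_add_distrib,
    sum_dite_mem hΩ (fun x' : ↥Ω => (v ∘ incl hΩ) x' * (P *ᵥ (v ∘ incl hΩ)) x')]

/-- **THE PADDED OPERATOR IS COERCIVE** with floor `min(σ,1)` when `P` is `σ`-coercive. [folklore] -/
theorem pad_coercive (hΩ : Ω ⊆ Ω₀) (P : Matrix ↥Ω ↥Ω ℝ) {σ : ℝ} (hPc : ∀ w, σ * (w ⬝ᵥ w) ≤ w ⬝ᵥ P *ᵥ w) (v : ↥Ω₀ → ℝ) :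
    min σ 1 * (v ⬝ᵥ v) ≤ v ⬝ᵥ pad Ω Ω₀ P *ᵥ v := by
  rw [pad_form hΩ, dot_split hΩ v, mul_add]
  have h0 : 0 ≤ (v ∘ incl hΩ) ⬝ᵥ (v ∘ incl hΩ) := Finset.sum_nonneg fun i _ => mul_self_nonneg _
  have h1 : min σ 1 * ((v ∘ incl hΩ) ⬝ᵥ (v ∘ incl hΩ)) ≤ (v ∘ incl hΩ) ⬝ᵥ P *ᵥ (v ∘ incl hΩ) :=
    (mul_le_mul_of_nonneg_right (min_le_left σ 1) h0).trans (hPc _)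
  have h2 : min σ 1 * ∑ x ∈ univ.filter (fun x : ↥Ω₀ => x.1 ∉ Ω), v x * v x ≤
      ∑ x ∈ univ.filter (fun x : ↥Ω₀ => x.1 ∉ Ω), v x * v x := by
    have h0' : 0 ≤ ∑ x ∈ univ.filter (fun x : ↥Ω₀ => x.1 ∉ Ω), v x * v x := Finset.sum_nonneg fun x _ => mul_self_nonneg _
    nlinarith [min_le_right σ 1]
  exact add_le_add h1 h2

/-- `pad` is multiplicative. [folklore] -/
theorem pad_mul (hΩ : Ω ⊆ Ω₀) (P Q : Matrix ↥Ω ↥Ω ℝ) : pad Ω Ω₀ (P * Q) = pad Ω Ω₀ P * pad Ω Ω₀ Q := by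
  ext x z
  rw [Matrix.mul_apply]
  by_cases hx : x.1 ∈ Ω
  · have h : ∀ y : ↥Ω₀, pad Ω Ω₀ P x y * pad Ω Ω₀ Q y z =
        if hy : y.1 ∈ Ω then (fun y' : ↥Ω => P ⟨x.1, hx⟩ y' * pad Ω Ω₀ Q (incl hΩ y') z) ⟨y.1, hy⟩ else 0 := by
      intro y
      by_cases hy : y.1 ∈ Ω
      · rw [dif_pos hy, pad_apply_mem_mem P hx hy]
        rfl
      · rw [dif_neg hy, pad_apply_mem_not_mem P hx hy, zero_mul]
    have key : ∑ y : ↥Ω₀, pad Ω Ω₀ P x y * pad Ω Ω₀ Q y z = ∑ y' : ↥Ω, P ⟨x.1, hx⟩ y' * pad Ω Ω₀ Q (incl hΩ y') z :=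
      (Finset.sum_congr rfl fun y _ => h y).trans
        (sum_dite_mem hΩ (fun y' : ↥Ω => P ⟨x.1, hx⟩ y' * pad Ω Ω₀ Q (incl hΩ y') z))
    rw [key]
    by_cases hz : z.1 ∈ Ω
    · rw [pad_apply_mem_mem (P * Q) hx hz, Matrix.mul_apply]
      refine Finset.sum_congr rfl fun y' _ => ?_
      exact (congrArg (fun t => P ⟨x.1, hx⟩ y' * t) (pad_incl hΩ Q y' ⟨z.1, hz⟩)).symm
    · rw [pad_apply_mem_not_mem (P * Q) hx hz]
      refine (Finset.sum_eq_zero fun y' _ => ?_).symm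
      rw [pad_apply_mem_not_mem Q (x := incl hΩ y') y'.2 hz, mul_zero]
  · simp_rw [pad_apply_not_mem P hx]
    simp only [ite_mul, one_mul, zero_mul, Finset.sum_ite_eq', Finset.mem_univ, if_true]
    rw [pad_apply_not_mem (P * Q) hx, pad_apply_not_mem Q hx]

/-- `pad` is unital. [folklore] -/
theorem pad_one (Ω Ω₀ : Finset α) : pad Ω Ω₀ (1 : Matrix ↥Ω ↥Ω ℝ) = 1 := by
  ext x y
  by_cases hx : x.1 ∈ Ω
  · by_cases hy : y.1 ∈ Ω
    · rw [pad_apply_mem_mem _ hx hy, Matrix.one_apply, Matrix.one_apply]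
      by_cases hxy : x = y
      · subst hxy; simp
      · have : (⟨x.1, hx⟩ : ↥Ω) ≠ ⟨y.1, hy⟩ := fun h => hxy (Subtype.ext (congrArg Subtype.val h :))
        rw [if_neg this, if_neg hxy]
    · rw [pad_apply_mem_not_mem _ hx hy, Matrix.one_apply]
      have : x ≠ y := fun h => hy (h ▸ hx)
      rw [if_neg this]
  · rw [pad_apply_not_mem _ hx, Matrix.one_apply]
    by_cases hxy : x = y
    · subst hxy; simp
    · rw [if_neg hxy, if_neg (Ne.symm hxy)]

/-- **THE INVERSE OF THE PADDED OPERATOR** is the padded inverse. [folklore] -/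
theorem pad_inv (hΩ : Ω ⊆ Ω₀) {P : Matrix ↥Ω ↥Ω ℝ} (h : P * P⁻¹ = 1) : (pad Ω Ω₀ P)⁻¹ = pad Ω Ω₀ P⁻¹ :=
  Matrix.inv_eq_right_inv (by rw [← pad_mul hΩ, h, pad_one])

/-- **THE CUT-OFF COMMUTATOR OF THE PADDED OPERATOR** is the zero-extension of `[diag(l|Ω), P](v|Ω)`. [folklore] -/
theorem comm_pad_mulVec (hΩ : Ω ⊆ Ω₀) (l : ↥Ω₀ → ℝ) (l' : ↥Ω → ℝ) (hl' : ∀ x', l (incl hΩ x') = l' x')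
    (P : Matrix ↥Ω ↥Ω ℝ) (v : ↥Ω₀ → ℝ) (x : ↥Ω₀) :
    (comm l (pad Ω Ω₀ P) *ᵥ v) x = if hx : x.1 ∈ Ω then (comm l' P *ᵥ (v ∘ incl hΩ)) ⟨x.1, hx⟩ else 0 := by
  simp only [mulVec, dotProduct, comm_apply]
  by_cases hx : x.1 ∈ Ω
  · rw [dif_pos hx]
    have h : ∀ y : ↥Ω₀, (l x - l y) * pad Ω Ω₀ P x y * v y =
        if hy : y.1 ∈ Ω then (fun y' : ↥Ω => (l x - l (incl hΩ y')) * P ⟨x.1, hx⟩ y' * v (incl hΩ y')) ⟨y.1, hy⟩ else 0 := by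
      intro y
      by_cases hy : y.1 ∈ Ω
      · rw [dif_pos hy, pad_apply_mem_mem P hx hy]
        rfl
      · rw [dif_neg hy, pad_apply_mem_not_mem P hx hy, mul_zero, zero_mul]
    have hx' : l x = l' ⟨x.1, hx⟩ := hl' ⟨x.1, hx⟩
    refine ((Finset.sum_congr rfl fun y _ => h y).trans
      (sum_dite_mem hΩ (fun y' : ↥Ω => (l x - l (incl hΩ y')) * P ⟨x.1, hx⟩ y' * v (incl hΩ y')))).trans ?_
    refine Finset.sum_congr rfl fun y' _ => ?_
    simp only [Function.comp_apply, hx', hl' y']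
  · rw [dif_neg hx]
    simp_rw [pad_apply_not_mem P hx]
    simp

/-- the squared norm of the padded commutator is that of the restricted one. [folklore] -/
theorem comm_pad_sq (hΩ : Ω ⊆ Ω₀) (l : ↥Ω₀ → ℝ) (l' : ↥Ω → ℝ) (hl' : ∀ x', l (incl hΩ x') = l' x')
    (P : Matrix ↥Ω ↥Ω ℝ) (v : ↥Ω₀ → ℝ) :
    comm l (pad Ω Ω₀ P) *ᵥ v ⬝ᵥ comm l (pad Ω Ω₀ P) *ᵥ v =
      comm l' P *ᵥ (v ∘ incl hΩ) ⬝ᵥ comm l' P *ᵥ (v ∘ incl hΩ) := by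
  simp only [dotProduct]
  have h : ∀ x : ↥Ω₀, (comm l (pad Ω Ω₀ P) *ᵥ v) x * (comm l (pad Ω Ω₀ P) *ᵥ v) x = (if hx : x.1 ∈ Ω then
      (fun x' : ↥Ω => (comm l' P *ᵥ (v ∘ incl hΩ)) x' * (comm l' P *ᵥ (v ∘ incl hΩ)) x') ⟨x.1, hx⟩ else 0) := by
    intro x
    rw [comm_pad_mulVec hΩ l l' hl']
    by_cases hx : x.1 ∈ Ω
    · rw [dif_pos hx, dif_pos hx]
    · rw [dif_neg hx, dif_neg hx, mul_zero]
  rw [Finset.sum_congr rfl fun x _ => h x,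
    sum_dite_mem hΩ (fun x' : ↥Ω => (comm l' P *ᵥ (v ∘ incl hΩ)) x' * (comm l' P *ᵥ (v ∘ incl hΩ)) x')]

/-- **(H-comm) TRANSFERS TO THE PADDED OPERATOR** with the same constants. [folklore] -/
theorem hcomm_pad (hΩ : Ω ⊆ Ω₀) (l : ↥Ω₀ → ℝ) (l' : ↥Ω → ℝ) (hl' : ∀ x', l (incl hΩ x') = l' x')
    (P : Matrix ↥Ω ↥Ω ℝ) {σ : ℝ} (hσ : 0 ≤ σ) (hPc : ∀ w, σ * (w ⬝ᵥ w) ≤ w ⬝ᵥ P *ᵥ w) {α2 β2 : ℝ} (hα : 0 ≤ α2)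
    (hβ : 0 ≤ β2) (hcomm : ∀ w, comm l' P *ᵥ w ⬝ᵥ comm l' P *ᵥ w ≤ α2 * (w ⬝ᵥ P *ᵥ w) + β2 * (w ⬝ᵥ w)) (v : ↥Ω₀ → ℝ) :
    comm l (pad Ω Ω₀ P) *ᵥ v ⬝ᵥ comm l (pad Ω Ω₀ P) *ᵥ v ≤ α2 * (v ⬝ᵥ pad Ω Ω₀ P *ᵥ v) + β2 * (v ⬝ᵥ v) := by
  rw [comm_pad_sq hΩ l l' hl', pad_form hΩ, dot_split hΩ v]
  have h0 : 0 ≤ ∑ x ∈ univ.filter (fun x : ↥Ω₀ => x.1 ∉ Ω), v x * v x := Finset.sum_nonneg fun x _ => mul_self_nonneg _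
  have h1 := hcomm (v ∘ incl hΩ)
  have h2 : 0 ≤ (v ∘ incl hΩ) ⬝ᵥ P *ᵥ (v ∘ incl hΩ) :=
    le_trans (mul_nonneg hσ (Finset.sum_nonneg fun i _ => mul_self_nonneg _)) (hPc _)
  nlinarith [mul_nonneg hα h0, mul_nonneg hβ h0]

/-- **CUT-OFF COMPATIBILITY TRANSFERS**: if `l` lives on `S` for an operator `P₀` on `Ω₀` whose OFF-DIAGONAL entries inside `Ω × Ω` are those of
`P`, then `l` lives on `S` for `pad P`. [folklore] -/
theorem cutoffOn_pad {P : Matrix ↥Ω ↥Ω ℝ} {P₀ : Matrix ↥Ω₀ ↥Ω₀ ℝ} {l : ↥Ω₀ → ℝ} {S : Finset ↥Ω₀} (h₀ : CutoffOn P₀ l S)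
    (hoff : ∀ (x y : ↥Ω₀) (hx : x.1 ∈ Ω) (hy : y.1 ∈ Ω), x ≠ y → P ⟨x.1, hx⟩ ⟨y.1, hy⟩ = P₀ x y) :
    CutoffOn (pad Ω Ω₀ P) l S := by
  refine ⟨h₀.1, fun x y hlx hyS => ?_⟩
  have hxS : x ∈ S := h₀.1 x hlx
  have hxy : x ≠ y := fun h => hyS (h ▸ hxS)
  obtain ⟨h1, h2⟩ := h₀.2 x y hlx hyS
  by_cases hx : x.1 ∈ Ω <;> by_cases hy : y.1 ∈ Ω
  · exact ⟨by rw [pad_apply_mem_mem P hx hy, hoff x y hx hy hxy, h1],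
      by rw [pad_apply_mem_mem P hy hx, hoff y x hy hx hxy.symm, h2]⟩
  · exact ⟨pad_apply_mem_not_mem P hx hy, by rw [pad_apply_not_mem P hy, if_neg hxy]⟩
  · exact ⟨by rw [pad_apply_not_mem P hx, if_neg hxy.symm], pad_apply_mem_not_mem P hy hx⟩
  · exact ⟨by rw [pad_apply_not_mem P hx, if_neg hxy.symm], by rw [pad_apply_not_mem P hy, if_neg hxy]⟩

end Pad

end Summit.QuantumFields.BalabanUV.T4Continuum.NE7K1LinWalkPad

end
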